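/-
Copyright (c) 2026 the pub-hodgecm-mathlib formalisation cell (harness21).  Prover seat hodgecm-mathlib-B-p14 (g43): the consumer file of «NORM LADDER for `K(√d)∕K` WILD,
define-free» (F0P3a-p06 (g18) deal (3) BY NAME; LH4 wild base-layer seam; census F0P3a-p06 (g17) `DUNR-H2-CENSUS.md` §3, mechanisms M4∕M6); 2026-09-02.
-/
import Literature.NumberTheory.LocalFields.WildQuadraticNormLadder   -- ★ the ladder core (universal witness, trace bound, normal forms); brings the whole wild quadratic layer
import HarnessLib

/-!
# Wild quadratic norms — NORM LADDER, consumer file: exact rungs, square-class transport of the depth letter, and the «every ramified non-square `d`» dress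
# with `f` pinned as THE conductor (`U^{(f)} ⊆ N_d`, a unit of depth `f − 1` outside, and `N(U_{K(√d)}^{(2n − f + 1)}) = U_K^{(n)}` exactly for all `n ≥ f`)

Topic `NumberTheory/LocalFields`; namespace `Literature.NumberTheory.LocalFields`.  THEOREMS ONLY (no definition, no instance, no notation, no named fact, no `sorry`);
CM-free; kernel lane `--supports stmt-HodgeConjecture-24833`.  Cell `pub/hodgecm-mathlib` (D-0151), crux H413 = `stmt-HodgeConjecture-24833`; half A line LH4, DYADIC
pay-down leaf `Cruxes/H413/Lines/F0_P3c_DyadicPaydown.lean`, organs (D-UNR)∕(D-RAM) (PRINT by D74′; census F0P3a-p06 (g17) OUTCOME B, mechanisms M4∕M6 key on the conductor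
`f` and on the norm groups of the unit filtration of the wild type-(2) tori `Res¹ L_w(√d)^×`).  Eleventh file of the wild quadratic layer; sequel of ★ `WildQuadraticNormLadder`
(B-p14 (g43)); define-free twin of ★ `Automorphic/RamifiedPlaceLevelNorms` (LH4-p03 (g5)).  HONEST LABEL: HC_CM is proved only modulo the 7 printed citations (2 remaining
named inputs: hLiu418 = stmt-HodgeConjecture-24832, h413 = stmt-HodgeConjecture-24833) until rung 0 closes; count-neutral, Mathlib-footed, bankable base layer.

CURRENCY (= ★ `WildQuadraticNormLadder`): `Valued.v : K → ℤᵐ⁰`; «`x ∈ N_d`» := `∃ a b, a·a − d·(b·b) = x`; DEPTH of a representation «`a + b√d ∈ U_E^{(m)}`» :=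
`Valued.v ((a − 1)·(a − 1) − d·(b·b)) ≤ exp(−m)`; break `t`, conductor `f = t + 1`, `ψ(n) = 2n − t = 2n − f + 1`.

* §1 `le_exp_neg_add_one_of_lt_exp_neg` — discreteness of `ℤᵐ⁰`: `x < exp(−j) ⇒ x ≤ exp(−(j + 1))`.
* §2 **SQUARE-CLASS TRANSPORT OF THE DEPTH LETTER**: `(d, b) ↦ (d·c·c, b∕c)` (`c ≠ 0`) fixes the norm `a·a − d·(b·b)` AND the depth `(a−1)·(a−1) − d·(b·b)` —
  `forall_sq_sub_mul_sq_depth_iff_mul_sq` (every ∀-clause in `(norm, depth)`), `exists_sq_sub_mul_sq_depth_le_iff_mul_sq` (the ∃-clause of (L1)); twin of ★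
  `exists_sq_sub_mul_sq_iff_mul_sq` (norm only).
* §3 **EXACT RUNGS** `normLadder_rung_exact`: for a uniformiser `ϖ` and `n ≥ t + 1`, `x = 1 + ϖⁿ` IS a norm from depth EXACTLY `exp(−(2n − t))` and every representation
  `a·a − d·(b·b) = 1 + ϖⁿ` has depth value `≥ exp(−(2n − t))` — `U^{(n)} ⊄ N(U_E^{(ψ(n)+1)})`: the rungs `N(U_E^{(ψ(n))}) = U^{(n)}`, `N(U_E^{(ψ(n)+1)}) = U^{(n+1)}` are sharp
  (Serre V §3 Cor. 3, both clauses).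
* §4 **THE CONSUMER DRESS** `normLadder_exists_conductor`: `K` complete with finite residue field, `2 ≠ 0`, `v 2 < 1`, uniformiser `ϖ`; `d ≠ 0` non-square with SOME unit
  not in `N_d` (= `K(√d)∕K` ramified, the negation of ★ (ii-0)'s class).  Then `∃ f : ℕ`, `1 ≤ f`, `v(4ϖ) ≤ exp(−f)` (`f ≤ 2e + 1`), `U^{(f)} ⊆ N_d`, a unit of depth EXACTLY
  `exp(−(f − 1))` outside `N_d` (so `f` is ★ (ii) `conductor_exists_of_forall_mul_self_ne`'s conductor, pinned by ★ (ii′)), AND for every `n ≥ f`: (L1) `U^{(n)} ⊆ N(U_E^{(2n − f + 1)})`,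
  (L2) `N(U_E^{(2n − f + 1)}) ⊆ U^{(n)}`, (L3) `N(U_E^{(2n − f + 2)}) ⊆ U^{(n+1)}` — assembled along ★ (C4) `exists_unit_mul_sq_depth_dichotomy` exactly as ★ (ii) is, the normal
  forms ★ `normLadder_of_valued_odd` ∕ ★ `normLadder_of_odd_defect` transported by §2, the conductor clauses from ★ `conductor_of_valued_odd` ∕ ★ `conductor_one_add_of_odd_defect`.
NOT HERE (honest scope): the unramified class (`f = 0`); the structure of `U^{(n)} ∩ N_d` for `n < f − 1` (index-2 pieces below the break).

## References
* [Serre1979] J.-P. Serre, *Local Fields*, GTM 67 (1979): Ch. V §3 Prop. 5 (iii) & Cor. 3; Ch. XV §2 (conductor via `U_K^{(n)}`); Ch. III §3 Prop. 7.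
* [NeukirchANT1999] J. Neukirch, *Algebraic Number Theory* (1999): Ch. V (1.2)–(1.3).
* [Omeara1963] O. T. O'Meara, *Introduction to Quadratic Forms*, Grundlehren 117 (1963), §63A 63:2–63:5, §63B 63:11a.
-/

set_option autoImplicit false

noncomputable section

open scoped Valued WithZero
open WithZero

namespace Literature.NumberTheory.LocalFields

/-! ## §1 Discreteness -/
section Discrete

/-- **DISCRETENESS** of `ℤᵐ⁰`: `x < exp(−j)` ⇒ `x ≤ exp(−(j + 1))`. [cite: Serre1979, Ch. II §1] -/
theorem le_exp_neg_add_one_of_lt_exp_neg {x : ℤᵐ⁰} {j : ℤ} (h : x < exp (-j)) : x ≤ exp (-(j + 1)) := by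
  by_cases hx : x = 0
  · rw [hx]
    exact zero_le
  · rw [← exp_log hx] at h ⊢
    rw [exp_lt_exp] at h
    rw [exp_le_exp]
    omega

end Discrete

section API
variable {K : Type*} [Field K] [Valued K ℤᵐ⁰]

/-! ## §2 Square-class transport of the depth letter -/

/-- **TRANSPORT (∀-clauses)**: for `c ≠ 0`, any property of the pair (norm, depth value) holds for all representations over `d` iff it holds for all representations over
`d·c·c` — `(a, b) ↦ (a, c·b)` one way, `(a, b) ↦ (a, b∕c)` the other; norm and depth are unchanged. [cite: Omeara1963, §63A 63:1–63:5] -/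
theorem forall_sq_sub_mul_sq_depth_iff_mul_sq (d : K) {c : K} (hc : c ≠ 0) (P : K → ℤᵐ⁰ → Prop) :
    (∀ a b : K, P (a * a - d * (b * b)) (Valued.v ((a - 1) * (a - 1) - d * (b * b)))) ↔
      ∀ a b : K, P (a * a - d * (c * c) * (b * b)) (Valued.v ((a - 1) * (a - 1) - d * (c * c) * (b * b))) := by
  constructor
  · intro h a b
    have h1 : a * a - d * (c * c) * (b * b) = a * a - d * (c * b * (c * b)) := by ring
    have h2 : (a - 1) * (a - 1) - d * (c * c) * (b * b) = (a - 1) * (a - 1) - d * (c * b * (c * b)) := by ring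
    rw [h1, h2]
    exact h a (c * b)
  · intro h a b
    have h1 : a * a - d * (b * b) = a * a - d * (c * c) * (b / c * (b / c)) := by field_simp
    have h2 : (a - 1) * (a - 1) - d * (b * b) = (a - 1) * (a - 1) - d * (c * c) * (b / c * (b / c)) := by field_simp
    rw [h1, h2]
    exact h a (b / c)

/-- **TRANSPORT (the ∃-clause of (L1))**: for `c ≠ 0`, `x` has a representation over `d` of depth value `≤ D` iff it has one over `d·c·c`.
[cite: Omeara1963, §63A 63:1–63:5] -/
theorem exists_sq_sub_mul_sq_depth_le_iff_mul_sq (d : K) {c : K} (hc : c ≠ 0) (x : K) (D : ℤᵐ⁰) :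
    (∃ a b : K, a * a - d * (b * b) = x ∧ Valued.v ((a - 1) * (a - 1) - d * (b * b)) ≤ D) ↔
      ∃ a b : K, a * a - d * (c * c) * (b * b) = x ∧ Valued.v ((a - 1) * (a - 1) - d * (c * c) * (b * b)) ≤ D := by
  have h := forall_sq_sub_mul_sq_depth_iff_mul_sq d hc (fun y D' => ¬ (y = x ∧ D' ≤ D))
  simp only [not_and] at h
  constructor
  · rintro ⟨a, b, hab, hD⟩
    by_contra hne
    push Not at hne
    exact (h.2 (fun a b hab' => by exact not_le.2 (hne a b hab'))) a b hab (by exact hD)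
  · rintro ⟨a, b, hab, hD⟩
    by_contra hne
    push Not at hne
    exact (h.1 (fun a b hab' => by exact not_le.2 (hne a b hab'))) a b hab (by exact hD)

/-! ## §3 Exact rungs -/

/-- **EXACT RUNGS.**  `K` with complete valuation ring, `d ≠ 1`, trace bound `hTB` (★ §2 of the core file) and `v 4 · exp t = v(1 − d)`; `ϖ` a uniformiser; `n ≥ t + 1`.
Then `1 + ϖⁿ` is a norm `a·a − d·(b·b)` from depth EXACTLY `exp(−(2n − t))` (the universal witness), and NO representation of `1 + ϖⁿ` is deeper: every `a b` with
`a·a − d·(b·b) = 1 + ϖⁿ` has `exp(−(2n − t)) ≤ v((a−1)·(a−1) − d·(b·b))` (else (L3) would put `ϖⁿ` in depth `n + 1`).  So `U^{(n)} = N(U_E^{(ψ(n))}) ⊋ N(U_E^{(ψ(n)+1)}) = U^{(n+1)}`.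
[cite: Serre1979, Ch. V §3 Prop. 5 (iii), Cor. 3] -/
theorem normLadder_rung_exact [IsAdicComplete 𝓂[K] 𝒪[K]] {d : K} (hd1 : d ≠ 1) {t : ℕ}
    (hTB : ∀ α β : K, Valued.v (α * α * (1 - d)) ≤ Valued.v (α * α - d * (β * β)))
    (ht : Valued.v (4 : K) * exp (t : ℤ) = Valued.v (1 - d)) {ϖ : K} (hϖ : Valued.v ϖ = exp (-1 : ℤ)) {n : ℕ} (hn : t + 1 ≤ n) :
    (∃ a b : K, a * a - d * (b * b) = 1 + ϖ ^ n ∧ Valued.v ((a - 1) * (a - 1) - d * (b * b)) = exp (-(2 * (n : ℤ) - t))) ∧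
      ∀ a b : K, a * a - d * (b * b) = 1 + ϖ ^ n → exp (-(2 * (n : ℤ) - t)) ≤ Valued.v ((a - 1) * (a - 1) - d * (b * b)) := by
  have hxn : Valued.v (1 + ϖ ^ n - 1 : K) = exp (-(n : ℤ)) := by
    rw [add_sub_cancel_left, ← zpow_natCast, valued_uniformizer_zpow hϖ]
  refine ⟨?_, fun a b hab => ?_⟩
  · obtain ⟨a, b, hN, heq, -⟩ := exists_sq_sub_mul_sq_eq_of_valued_sub_one_le_exp_neg hd1 ht hn hxn.le
    refine ⟨a, b, hN, ?_⟩
    rw [heq, hxn, pow_two, ← exp_add, ← exp_add]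
    congr 1
    ring
  · by_contra hlt
    rw [not_le] at hlt
    have hle : Valued.v ((a - 1) * (a - 1) - d * (b * b)) ≤ exp (-(2 * (n : ℤ) - t + 1)) := le_exp_neg_add_one_of_lt_exp_neg hlt
    have h := valued_sq_sub_mul_sq_sub_one_le_exp_neg (n := (n : ℤ) + 1) hTB ht hle (by omega) (by omega)
    rw [hab, hxn, exp_le_exp] at h
    omega

/-! ## §4 The consumer dress: every ramified non-square `d`, `f` pinned as the conductor -/

/-- **NORM LADDER WITH THE CONDUCTOR PINNED, FOR EVERY RAMIFIED NON-SQUARE `d`.**  `K` complete with finite residue field, `2 ≠ 0`, `v 2 < 1`, uniformiser `ϖ`; `d ≠ 0` not a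
square, and some unit is NOT in `N_d` (`K(√d)∕K` ramified).  Then there is `f : ℕ` with `1 ≤ f`, `v(4ϖ) ≤ exp(−f)` (`f ≤ 2e + 1`), `U^{(f)} ⊆ N_d`, a unit of depth exactly
`exp(−(f − 1))` outside `N_d` — i.e. `f` is THE conductor of ★ (ii)∕(ii′) — and for every `n ≥ f`, with `ψ(n) = 2n − f + 1`: (L1) every `x` with `v(x − 1) ≤ exp(−n)` is
`a·a − d·(b·b)` with depth `≤ exp(−ψ(n))`; (L2) depth `≤ exp(−ψ(n))` ⇒ norm in `U^{(n)}`; (L3) depth `≤ exp(−(ψ(n) + 1))` ⇒ norm in `U^{(n+1)}`.  Assembly: ★ (C4) square-class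
normal form (`f = 2e + 1` for odd order via ★ `normLadder_of_valued_odd` ∕ ★ `conductor_of_valued_odd`; `f = 2e + 1 − s` for odd defect via ★ `normLadder_of_odd_defect` ∕
★ `conductor_one_add_of_odd_defect`; the `Δ`-class is excluded by the non-norm unit through ★ (ii-0)), transported by §2 and ★ `exists_sq_sub_mul_sq_iff_mul_sq`.
[cite: Serre1979, Ch. V §3 Cor. 3; Ch. XV §2] [cite: NeukirchANT1999, Ch. V (1.2)–(1.3)] [cite: Omeara1963, §63A 63:2; §63B 63:11a] -/
theorem normLadder_exists_conductor [IsAdicComplete 𝓂[K] 𝒪[K]] [Finite 𝓀[K]] (h2 : (2 : K) ≠ 0) (h2v : Valued.v (2 : K) < 1)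
    {ϖ : K} (hϖ : Valued.v ϖ = exp (-1 : ℤ)) {d : K} (hd0 : d ≠ 0) (hns : ∀ r : K, r * r ≠ d)
    (hram : ∃ u : K, Valued.v u = 1 ∧ ¬ ∃ a b : K, a * a - d * (b * b) = u) :
    ∃ f : ℕ, 1 ≤ f ∧ Valued.v ((4 : K) * ϖ) ≤ exp (-(f : ℤ)) ∧
      (∀ x : K, Valued.v x = 1 → Valued.v (x - 1) ≤ exp (-(f : ℤ)) → ∃ a b : K, a * a - d * (b * b) = x) ∧
      (∃ x : K, Valued.v x = 1 ∧ Valued.v (x - 1) = exp (-((f : ℤ) - 1)) ∧ ¬ ∃ a b : K, a * a - d * (b * b) = x) ∧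
      ∀ n : ℕ, f ≤ n →
        (∀ x : K, Valued.v (x - 1) ≤ exp (-(n : ℤ)) →
            ∃ a b : K, a * a - d * (b * b) = x ∧ Valued.v ((a - 1) * (a - 1) - d * (b * b)) ≤ exp (-(2 * (n : ℤ) - f + 1))) ∧
          (∀ a b : K, Valued.v ((a - 1) * (a - 1) - d * (b * b)) ≤ exp (-(2 * (n : ℤ) - f + 1)) →
            Valued.v (a * a - d * (b * b) - 1) ≤ exp (-(n : ℤ))) ∧
          (∀ a b : K, Valued.v ((a - 1) * (a - 1) - d * (b * b)) ≤ exp (-(2 * (n : ℤ) - f + 2)) →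
            Valued.v (a * a - d * (b * b) - 1) ≤ exp (-((n : ℤ) + 1))) := by
  have hres := exists_valued_mul_self_sub_lt_one_of_finite_residueField (K := K) h2v
  obtain ⟨e, he1, he⟩ := exists_valued_two_eq_exp_nat h2 h2v
  have hϖ0 : ϖ ≠ 0 := (Valuation.ne_zero_iff _).1 (by rw [hϖ]; exact exp_ne_zero)
  have hvd0 : Valued.v d ≠ 0 := (Valuation.ne_zero_iff _).2 hd0
  have hv4 : Valued.v (4 : K) = exp (-(2 * (e : ℤ))) := by
    rw [show (4 : K) = 2 * 2 by norm_num, map_mul, he, ← exp_add]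
    congr 1
    ring
  have hv4ϖ : Valued.v ((4 : K) * ϖ) = exp (-(2 * (e : ℤ) + 1)) := by
    rw [map_mul, hv4, hϖ, ← exp_add]
    congr 1
    ring
  rcases Int.even_or_odd (log (Valued.v d)) with ⟨r, hr⟩ | ⟨j, hj⟩
  · -- even order: move to the unit `d₁ = d·(ϖ^r)²`, then (C4) to the normal form `z = d·(c·c)`
    have hs0 : ϖ ^ r ≠ 0 := zpow_ne_zero _ hϖ0
    have hunit : Valued.v (d * (ϖ ^ r * ϖ ^ r)) = 1 := by
      rw [map_mul, map_mul, valued_uniformizer_zpow hϖ, ← exp_log hvd0, hr, ← exp_add, ← exp_add, ← exp_zero]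
      congr 1
      ring
    obtain ⟨t, ht1, hdich⟩ := exists_unit_mul_sq_depth_dichotomy h2 h2v hres hϖ hunit
    have ht0 : t ≠ 0 := (Valuation.ne_zero_iff _).1 (by rw [ht1]; exact one_ne_zero)
    have hc0 : ϖ ^ r * t ≠ 0 := mul_ne_zero hs0 ht0
    set z : K := d * (ϖ ^ r * ϖ ^ r) * (t * t) with hz
    have hzc : z = d * (ϖ ^ r * t * (ϖ ^ r * t)) := by rw [hz]; ring
    clear_value z
    -- norms over `d` = norms over `z`
    have htr : ∀ x : K, (∃ a b : K, a * a - d * (b * b) = x) ↔ ∃ a b : K, a * a - z * (b * b) = x := by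
      intro x
      rw [hzc]
      exact exists_sq_sub_mul_sq_iff_mul_sq d hc0 x
    rcases hdich with hdeep | ⟨h4z, hz1, hzodd⟩
    · -- the `Δ`-class: every unit is a norm — excluded by `hram`
      exfalso
      obtain ⟨u, hu1, huN⟩ := hram
      have hzns : ∀ r' : K, r' * r' ≠ z := by
        intro r' hr'
        refine hns (r' * (ϖ ^ r * t)⁻¹) ?_
        rw [hzc] at hr'
        field_simp
        linear_combination hr'
      exact huN ((htr u).2 ((normGroup_of_valued_sub_one_le_four h2 h2v hdeep hzns).1 u hu1))
    · -- odd defect `s`: `f = 2e + 1 − s`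
      have hw0 : Valued.v (z - 1) ≠ 0 := fun h => hzodd 0 (by rw [h, map_zero, mul_zero])
      obtain ⟨s, hs⟩ : ∃ s : ℕ, log (Valued.v (z - 1)) = -(s : ℤ) := by
        refine Int.exists_eq_neg_ofNat ?_
        rw [← exp_le_exp, exp_log hw0, exp_zero]
        exact hz1.le
      have hws : Valued.v (z - 1) = exp (-(s : ℤ)) := by rw [← hs, exp_log hw0]
      have hs1 : 1 ≤ s ∧ s + 1 ≤ 2 * e := by
        have h1 := hz1
        have h2' := h4z
        rw [hws, ← exp_zero, exp_lt_exp] at h1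
        rw [hws, hv4, exp_lt_exp] at h2'
        omega
      obtain ⟨hC1, x, hx1, hxd, hxN⟩ := conductor_one_add_of_odd_defect h2 h2v hz1 h4z hzodd
      have hz' : 1 + (z - 1) = z := by ring
      rw [hz'] at hC1 hxN
      refine ⟨2 * e + 1 - s, by omega, ?_, fun y hy hyd => ?_, ⟨x, hx1, ?_, fun h => hxN ((htr x).1 h)⟩, fun n hn => ?_⟩
      · rw [hv4ϖ, exp_le_exp]
        omega
      · refine (htr y).2 (hC1 y ?_)
        rw [map_mul, hws, hv4]
        calc exp (-(s : ℤ)) * Valued.v (y - 1) ≤ exp (-(s : ℤ)) * exp (-((2 * e + 1 - s : ℕ) : ℤ)) := mul_le_mul_right hyd _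
          _ < exp (-(2 * (e : ℤ))) := by
              rw [← exp_add, exp_lt_exp]
              push_cast [show s ≤ 2 * e + 1 by omega]
              omega
      · have h := hxd
        rw [map_mul, hws, hv4] at h
        have hx0 : Valued.v (x - 1) ≠ 0 := by
          intro h0
          rw [h0, mul_zero] at h
          exact exp_ne_zero h.symm
        rw [← exp_log hx0, ← exp_add, exp_inj] at h
        rw [← exp_log hx0, exp_inj]
        push_cast [show s ≤ 2 * e + 1 by omega]
        omega
      · -- the ladder over `z`, transported back to `d`
        obtain ⟨hL1, hL2, hL3⟩ := normLadder_of_odd_defect he hws h4z hzodd (n := n) (by omega)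
        have hψ : (2 * (n : ℤ) - ((2 * e + 1 - s : ℕ) : ℤ) + 1) = 2 * (n : ℤ) - 2 * e + s := by
          push_cast [show s ≤ 2 * e + 1 by omega]
          ring
        have hψ' : (2 * (n : ℤ) - ((2 * e + 1 - s : ℕ) : ℤ) + 2) = 2 * (n : ℤ) - 2 * e + s + 1 := by
          push_cast [show s ≤ 2 * e + 1 by omega]
          ring
        rw [hψ, hψ']
        refine ⟨fun y hy => ?_, ?_, ?_⟩
        · rw [exists_sq_sub_mul_sq_depth_le_iff_mul_sq d hc0, ← hzc]
          exact hL1 y hy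
        · rw [forall_sq_sub_mul_sq_depth_iff_mul_sq d hc0 (fun y D => D ≤ exp (-(2 * (n : ℤ) - 2 * e + s)) → Valued.v (y - 1) ≤ exp (-(n : ℤ))), ← hzc]
          exact hL2
        · rw [forall_sq_sub_mul_sq_depth_iff_mul_sq d hc0 (fun y D => D ≤ exp (-(2 * (n : ℤ) - 2 * e + s + 1)) → Valued.v (y - 1) ≤ exp (-((n : ℤ) + 1))), ← hzc]
          exact hL3
  · -- odd order: `f = 2e + 1`; for the ladder move to `z = d·(ϖ^(j+1))²` of value `exp(−1)`
    have hdodd : ∀ y : K, Valued.v d ≠ Valued.v y * Valued.v y :=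
      valued_ne_mul_self_of_eq_exp_odd (n := j) (by rw [← exp_log hvd0, hj])
    obtain ⟨hW1, x, hx1, hxd, hxN⟩ := conductor_of_valued_odd h2 h2v hdodd
    have hc0 : ϖ ^ (j + 1) ≠ 0 := zpow_ne_zero _ hϖ0
    set z : K := d * (ϖ ^ (j + 1) * ϖ ^ (j + 1)) with hz
    have hzv : Valued.v z = exp (-1 : ℤ) := by
      rw [hz, map_mul, map_mul, valued_uniformizer_zpow hϖ, ← exp_log hvd0, hj, ← exp_add, ← exp_add]
      congr 1
      ring
    have hzlt : Valued.v z < 1 := by rw [hzv, ← exp_zero, exp_lt_exp]; omega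
    have hzodd : ∀ y : K, Valued.v z ≠ Valued.v y * Valued.v y :=
      valued_ne_mul_self_of_eq_exp_odd (n := -1) (by rw [hzv]; congr 1)
    refine ⟨2 * e + 1, by omega, by rw [hv4ϖ]; push_cast; exact le_rfl, fun y _ hyd => hW1 y ?_, ⟨x, hx1, ?_, hxN⟩, fun n hn => ?_⟩
    · refine hyd.trans_lt ?_
      rw [hv4, exp_lt_exp]
      push_cast
      omega
    · rw [hxd, hv4]
      congr 1
      push_cast
      ring
    · obtain ⟨hL1, hL2, hL3⟩ := normLadder_of_valued_odd he hzlt hzodd (n := n) (by omega)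
      have hψ : (2 * (n : ℤ) - ((2 * e + 1 : ℕ) : ℤ) + 1) = 2 * (n : ℤ) - 2 * e := by push_cast; ring
      have hψ' : (2 * (n : ℤ) - ((2 * e + 1 : ℕ) : ℤ) + 2) = 2 * (n : ℤ) - 2 * e + 1 := by push_cast; ring
      rw [hψ, hψ']
      refine ⟨fun y hy => ?_, ?_, ?_⟩
      · rw [exists_sq_sub_mul_sq_depth_le_iff_mul_sq d hc0, ← hz]
        exact hL1 y hy
      · rw [forall_sq_sub_mul_sq_depth_iff_mul_sq d hc0 (fun y D => D ≤ exp (-(2 * (n : ℤ) - 2 * e)) → Valued.v (y - 1) ≤ exp (-(n : ℤ))), ← hz]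
        exact hL2
      · rw [forall_sq_sub_mul_sq_depth_iff_mul_sq d hc0 (fun y D => D ≤ exp (-(2 * (n : ℤ) - 2 * e + 1)) → Valued.v (y - 1) ≤ exp (-((n : ℤ) + 1))), ← hz]
        exact hL3

end API

end Literature.NumberTheory.LocalFields
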